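import Summits.AtomisticToContinuum.Crystallization.Theorems.FrustratedLawDichotomyCellArithNashIntFlat

/-!
# FrustratedLawDichotomy · crux `AperiodicFrustratedLawGap` (stmt-AtomisticToContinuum-27623) — CELL-ARITH, the per-LABEL ACCUMULATOR
# (critic r1801 (i): «a List foldl of linLabIF rows returning the six running integer bounds + its _mem lemma against nashI_mem — the
# evaluated term should be one foldl over a list literal per representative label»; decomp-a2c hand-1 g53)

For a label `m` the K-file holds two duplicate-free LISTS of labels: `lOwn` (= (252)'s own-multiplier near set
`(M.erase m).filter (· ∈ nb m)`, used iff `m ∈ MI`) and `lNbr` (= `(MI.erase m).filter (· ∈ nb m)`); the accumulator folds the FLAT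
per-pair box `…CellArithNashIntFlat.linLabIF` over them — subtracting (bounds swapped) the own rows, adding the neighbour rows — starting
from the lead box.  ★ `nashAccF` + fold algebra (`foldl_accAdd`, `foldl_accSub`) + ★ `nashAccF_mem`: the six outputs bound
`Σ·(nashVecLab G M MI a ω nb m) i`, `Σ = S·D·ed·hd²`, from both sides (hypotheses = `nashI_mem`'s + the two list↔finset facts) — so the
label's `WL/WH` for `…CellArithGram.norm_posL_le_of_gramHiZ2` come out of ONE kernel fold.
Computable `def`s; imports `…CellArithNashIntFlat`; 0 sorry.  Tags: [folklore].
-/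

namespace Summit.AtomisticToContinuum.Crystallization.Theorems.FrustratedLawDichotomyCellArithNashFold

open scoped BigOperators
open Summit.AtomisticToContinuum.Crystallization.Theorems.FrustratedLawDichotomyCoherentFloorAlgebra (psiT psiT1)
open Summit.AtomisticToContinuum.Crystallization.Theorems.FrustratedLawDichotomyCellMetric (gram linLab nashVecLab)
open Summit.AtomisticToContinuum.Crystallization.Theorems.FrustratedLawDichotomyCellArithNashInt
  (izLo izHi izLo_le le_izHi leadILo leadIHi leadI_mem)
open Summit.AtomisticToContinuum.Crystallization.Theorems.FrustratedLawDichotomyCellArithNashIntFlat (linLabIF linLabIF_mem)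

variable {ι : Type*} [DecidableEq ι]

/-- the running box: `(lo₀, hi₀, lo₁, hi₁, lo₂, hi₂)`. -/
abbrev Box6 := ℤ × ℤ × ℤ × ℤ × ℤ × ℤ

/-- add a pair box (neighbour rows). [folklore] -/
def accAdd (acc b : Box6) : Box6 :=
  (acc.1 + b.1, acc.2.1 + b.2.1, acc.2.2.1 + b.2.2.1, acc.2.2.2.1 + b.2.2.2.1, acc.2.2.2.2.1 + b.2.2.2.2.1, acc.2.2.2.2.2 + b.2.2.2.2.2)

/-- subtract a pair box with bounds swapped (own-multiplier rows enter with a minus sign). [folklore] -/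
def accSub (acc b : Box6) : Box6 :=
  (acc.1 - b.2.1, acc.2.1 - b.1, acc.2.2.1 - b.2.2.2.1, acc.2.2.2.1 - b.2.2.1, acc.2.2.2.2.1 - b.2.2.2.2.2, acc.2.2.2.2.2 - b.2.2.2.2.1)

/-- the flat box of the pair `(m, x)` with partner data read from tables indexed by the partner. -/
def ownRow (m : ι) (z w : ι → Fin 3 → ℤ) (ed en hn hd : ℤ) (PL PH P1L P1H : ι → ℤ) (m' : ι) : Box6 :=
  linLabIF (PL m') (PH m') (P1L m') (P1H m') ed en hn hd (z m 0 - z m' 0) (z m 1 - z m' 1) (z m 2 - z m' 2) (w m 0) (w m 1) (w m 2)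

/-- the flat box of the neighbour pair `(x, m)` (multiplier of `x`). -/
def nbrRow (m : ι) (z w : ι → Fin 3 → ℤ) (ed en hn hd : ℤ) (PL' PH' P1L' P1H' : ι → ℤ) (x : ι) : Box6 :=
  linLabIF (PL' x) (PH' x) (P1L' x) (P1H' x) ed en hn hd (z x 0 - z m 0) (z x 1 - z m 1) (z x 2 - z m 2) (w x 0) (w x 1) (w x 2)

/-- ★ THE PER-LABEL ACCUMULATOR: start from the lead box, subtract the own rows (iff `own`), add the neighbour rows — ONE fold each. [folklore] -/
def nashAccF (m : ι) (z w : ι → Fin 3 → ℤ) (D ed en hn hd P0L P0H : ℤ) (PL PH P1L P1H PL' PH' P1L' P1H' : ι → ℤ)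
    (own : Bool) (lOwn lNbr : List ι) : Box6 :=
  let lead : Box6 := (leadILo P0L P0H D ed hn hd (z m) 0, leadIHi P0L P0H D ed hn hd (z m) 0,
    leadILo P0L P0H D ed hn hd (z m) 1, leadIHi P0L P0H D ed hn hd (z m) 1,
    leadILo P0L P0H D ed hn hd (z m) 2, leadIHi P0L P0H D ed hn hd (z m) 2)
  let acc1 := if own then lOwn.foldl (fun acc m' => accSub acc (ownRow m z w ed en hn hd PL PH P1L P1H m')) lead else lead
  lNbr.foldl (fun acc x => accAdd acc (nbrRow m z w ed en hn hd PL' PH' P1L' P1H' x)) acc1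

/-! ## fold algebra -/

/-- `foldl accAdd` adds the componentwise list sums. [folklore] -/
theorem foldl_accAdd {α : Type*} (f : α → Box6) :
    ∀ (l : List α) (a : Box6), l.foldl (fun acc x => accAdd acc (f x)) a
      = (a.1 + (l.map fun x => (f x).1).sum, a.2.1 + (l.map fun x => (f x).2.1).sum, a.2.2.1 + (l.map fun x => (f x).2.2.1).sum,
         a.2.2.2.1 + (l.map fun x => (f x).2.2.2.1).sum, a.2.2.2.2.1 + (l.map fun x => (f x).2.2.2.2.1).sum,
         a.2.2.2.2.2 + (l.map fun x => (f x).2.2.2.2.2).sum)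
  | [], a => by simp
  | x :: l, a => by
    rw [List.foldl_cons, foldl_accAdd f l]
    simp only [accAdd, List.map_cons, List.sum_cons]
    refine Prod.ext ?_ (Prod.ext ?_ (Prod.ext ?_ (Prod.ext ?_ (Prod.ext ?_ ?_)))) <;> simp only <;> ring

/-- `foldl accSub` subtracts the componentwise list sums with bounds swapped. [folklore] -/
theorem foldl_accSub {α : Type*} (f : α → Box6) :
    ∀ (l : List α) (a : Box6), l.foldl (fun acc x => accSub acc (f x)) a
      = (a.1 - (l.map fun x => (f x).2.1).sum, a.2.1 - (l.map fun x => (f x).1).sum, a.2.2.1 - (l.map fun x => (f x).2.2.2.1).sum,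
         a.2.2.2.1 - (l.map fun x => (f x).2.2.1).sum, a.2.2.2.2.1 - (l.map fun x => (f x).2.2.2.2.2).sum,
         a.2.2.2.2.2 - (l.map fun x => (f x).2.2.2.2.1).sum)
  | [], a => by simp
  | x :: l, a => by
    rw [List.foldl_cons, foldl_accSub f l]
    simp only [accSub, List.map_cons, List.sum_cons]
    refine Prod.ext ?_ (Prod.ext ?_ (Prod.ext ?_ (Prod.ext ?_ (Prod.ext ?_ ?_)))) <;> simp only <;> ring

/-! ## soundness -/

section Mem

variable {S D ed en hn hd P0L P0H : ℤ} {G : Matrix (Fin 3) (Fin 3) ℝ} {ε : ℝ} {M MI : Finset ι} {nb : ι → Finset ι} {m : ι}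
  {z w : ι → Fin 3 → ℤ} {a ω : ι → Fin 3 → ℝ} {PL PH P1L P1H PL' PH' P1L' P1H' : ι → ℤ} {lOwn lNbr : List ι}

/-- a list of lower readings over a `Nodup` list enumerating `s` sums to a lower reading of the `Finset` sum. -/
theorem list_sum_le_finset {Sg : ℤ} {T : ι → ℤ} {f : ι → ℝ} {l : List ι} {s : Finset ι} (hl : l.toFinset = s) (hn : l.Nodup)
    (h : ∀ x ∈ s, ((T x : ℤ) : ℝ) ≤ (Sg : ℝ) * f x) : (((l.map T).sum : ℤ) : ℝ) ≤ (Sg : ℝ) * ∑ x ∈ s, f x := by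
  rw [← hl, List.sum_toFinset _ hn]
  exact Summit.AtomisticToContinuum.Crystallization.Theorems.FrustratedLawDichotomyCellArith.list_sum_readings_le Sg T f l
    (fun x hx => h x (hl ▸ List.mem_toFinset.2 hx))

/-- upper version. -/
theorem finset_le_list_sum {Sg : ℤ} {T : ι → ℤ} {f : ι → ℝ} {l : List ι} {s : Finset ι} (hl : l.toFinset = s) (hn : l.Nodup)
    (h : ∀ x ∈ s, (Sg : ℝ) * f x ≤ ((T x : ℤ) : ℝ)) : (Sg : ℝ) * ∑ x ∈ s, f x ≤ (((l.map T).sum : ℤ) : ℝ) := by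
  rw [← hl, List.sum_toFinset _ hn]
  exact Summit.AtomisticToContinuum.Crystallization.Theorems.FrustratedLawDichotomyCellArith.le_list_sum_readings Sg T f l
    (fun x hx => h x (hl ▸ List.mem_toFinset.2 hx))

/-- ★ SOUNDNESS OF THE ACCUMULATOR: with `nashI_mem`'s hypotheses and the two list↔finset facts, the six outputs of `nashAccF` bound
`Σ·(nashVecLab G M MI a ω nb m) i` (`Σ = S·D·ed·hd²`) from both sides, coordinate by coordinate. [folklore] -/
theorem nashAccF_mem (hG : ∀ i j, |G i j - (if i = j then 1 else 0)| ≤ ε) (hε : ε = (en : ℝ) / (ed : ℝ)) (hed : 0 < ed)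
    (hD : 0 < D) (hhd : 0 < hd) (ha : ∀ x j, a x j = (hn : ℝ) / (hd : ℝ) * (z x j : ℝ)) (hω : ∀ x j, ω x j = (w x j : ℝ) / (D : ℝ))
    (h0L : (P0L : ℝ) ≤ S * psiT (gram G (a m) (a m))) (h0H : S * psiT (gram G (a m) (a m)) ≤ (P0H : ℝ))
    (hown : ∀ m' ∈ (M.erase m).filter (fun m' => m' ∈ nb m),
      (PL m' : ℝ) ≤ S * psiT (gram G (a m - a m') (a m - a m')) ∧ S * psiT (gram G (a m - a m') (a m - a m')) ≤ (PH m' : ℝ)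
        ∧ (P1L m' : ℝ) ≤ S * psiT1 (gram G (a m - a m') (a m - a m'))
        ∧ S * psiT1 (gram G (a m - a m') (a m - a m')) ≤ (P1H m' : ℝ))
    (hnbr : ∀ x ∈ (MI.erase m).filter (fun x => x ∈ nb m),
      (PL' x : ℝ) ≤ S * psiT (gram G (a x - a m) (a x - a m)) ∧ S * psiT (gram G (a x - a m) (a x - a m)) ≤ (PH' x : ℝ)
        ∧ (P1L' x : ℝ) ≤ S * psiT1 (gram G (a x - a m) (a x - a m))
        ∧ S * psiT1 (gram G (a x - a m) (a x - a m)) ≤ (P1H' x : ℝ))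
    (hlo : lOwn.toFinset = (M.erase m).filter (fun m' => m' ∈ nb m)) (hlon : lOwn.Nodup)
    (hln : lNbr.toFinset = (MI.erase m).filter (fun x => x ∈ nb m)) (hlnn : lNbr.Nodup) {own : Bool} (hownb : own = decide (m ∈ MI)) :
    let R := nashAccF m z w D ed en hn hd P0L P0H PL PH P1L P1H PL' PH' P1L' P1H' own lOwn lNbr
    let Sg : ℝ := ((S * D * ed * hd ^ 2 : ℤ) : ℝ)
    ((R.1 : ℝ) ≤ Sg * nashVecLab G M MI a ω nb m 0 ∧ Sg * nashVecLab G M MI a ω nb m 0 ≤ (R.2.1 : ℝ))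
      ∧ ((R.2.2.1 : ℝ) ≤ Sg * nashVecLab G M MI a ω nb m 1 ∧ Sg * nashVecLab G M MI a ω nb m 1 ≤ (R.2.2.2.1 : ℝ))
      ∧ ((R.2.2.2.2.1 : ℝ) ≤ Sg * nashVecLab G M MI a ω nb m 2 ∧ Sg * nashVecLab G M MI a ω nb m 2 ≤ (R.2.2.2.2.2 : ℝ)) := by
  dsimp only
  -- per-row boxes
  have A : ∀ m' ∈ (M.erase m).filter (fun m' => m' ∈ nb m),
      let B := ownRow m z w ed en hn hd PL PH P1L P1H m'
      let Sg : ℝ := ((S * D * ed * hd ^ 2 : ℤ) : ℝ)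
      ((B.1 : ℝ) ≤ Sg * linLab G (a m - a m') (ω m) 0 ∧ Sg * linLab G (a m - a m') (ω m) 0 ≤ (B.2.1 : ℝ))
        ∧ ((B.2.2.1 : ℝ) ≤ Sg * linLab G (a m - a m') (ω m) 1 ∧ Sg * linLab G (a m - a m') (ω m) 1 ≤ (B.2.2.2.1 : ℝ))
        ∧ ((B.2.2.2.2.1 : ℝ) ≤ Sg * linLab G (a m - a m') (ω m) 2 ∧ Sg * linLab G (a m - a m') (ω m) 2 ≤ (B.2.2.2.2.2 : ℝ)) := by
    intro m' hm'
    obtain ⟨p1, p2, p3, p4⟩ := hown m' hm'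
    exact linLabIF_mem (z := fun j => z m j - z m' j) (w := w m) hG hε hed hD hhd
      (fun j => by simp only [Pi.sub_apply, ha]; push_cast; ring) (hω m) p1 p2 p3 p4
  have B : ∀ x ∈ (MI.erase m).filter (fun x => x ∈ nb m),
      let B := nbrRow m z w ed en hn hd PL' PH' P1L' P1H' x
      let Sg : ℝ := ((S * D * ed * hd ^ 2 : ℤ) : ℝ)
      ((B.1 : ℝ) ≤ Sg * linLab G (a x - a m) (ω x) 0 ∧ Sg * linLab G (a x - a m) (ω x) 0 ≤ (B.2.1 : ℝ))
        ∧ ((B.2.2.1 : ℝ) ≤ Sg * linLab G (a x - a m) (ω x) 1 ∧ Sg * linLab G (a x - a m) (ω x) 1 ≤ (B.2.2.2.1 : ℝ))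
        ∧ ((B.2.2.2.2.1 : ℝ) ≤ Sg * linLab G (a x - a m) (ω x) 2 ∧ Sg * linLab G (a x - a m) (ω x) 2 ≤ (B.2.2.2.2.2 : ℝ)) := by
    intro x hx
    obtain ⟨p1, p2, p3, p4⟩ := hnbr x hx
    exact linLabIF_mem (z := fun j => z x j - z m j) (w := w x) hG hε hed hD hhd
      (fun j => by simp only [Pi.sub_apply, ha]; push_cast; ring) (hω x) p1 p2 p3 p4
  have L := fun i => leadI_mem (S := S) (D := D) (ed := ed) (PL := P0L) (PH := P0H) (i := i) hhd (ha m) h0L h0H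
  -- coordinate expansion of nashVecLab
  have e : ∀ i, nashVecLab G M MI a ω nb m i = (psiT (gram G (a m) (a m)) • a m) i
      - (if m ∈ MI then ∑ m' ∈ (M.erase m).filter (fun m' => m' ∈ nb m), linLab G (a m - a m') (ω m) i else 0)
      + ∑ x ∈ (MI.erase m).filter (fun x => x ∈ nb m), linLab G (a x - a m) (ω x) i := by
    intro i
    unfold nashVecLab
    by_cases h : m ∈ MI
    · simp [h, Finset.sum_apply]; ring
    · simp [h, Finset.sum_apply]
  -- list sums ↔ finset sums, per component
  have O1 := finset_le_list_sum (T := fun m' => (ownRow m z w ed en hn hd PL PH P1L P1H m').2.1) hlo hlon (fun m' hm' => (A m' hm').1.2)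
  have O2 := list_sum_le_finset (T := fun m' => (ownRow m z w ed en hn hd PL PH P1L P1H m').1) hlo hlon (fun m' hm' => (A m' hm').1.1)
  have O3 := finset_le_list_sum (T := fun m' => (ownRow m z w ed en hn hd PL PH P1L P1H m').2.2.2.1) hlo hlon (fun m' hm' => (A m' hm').2.1.2)
  have O4 := list_sum_le_finset (T := fun m' => (ownRow m z w ed en hn hd PL PH P1L P1H m').2.2.1) hlo hlon (fun m' hm' => (A m' hm').2.1.1)
  have O5 := finset_le_list_sum (T := fun m' => (ownRow m z w ed en hn hd PL PH P1L P1H m').2.2.2.2.2) hlo hlon (fun m' hm' => (A m' hm').2.2.2)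
  have O6 := list_sum_le_finset (T := fun m' => (ownRow m z w ed en hn hd PL PH P1L P1H m').2.2.2.2.1) hlo hlon (fun m' hm' => (A m' hm').2.2.1)
  have N1 := list_sum_le_finset (T := fun x => (nbrRow m z w ed en hn hd PL' PH' P1L' P1H' x).1) hln hlnn (fun x hx => (B x hx).1.1)
  have N2 := finset_le_list_sum (T := fun x => (nbrRow m z w ed en hn hd PL' PH' P1L' P1H' x).2.1) hln hlnn (fun x hx => (B x hx).1.2)
  have N3 := list_sum_le_finset (T := fun x => (nbrRow m z w ed en hn hd PL' PH' P1L' P1H' x).2.2.1) hln hlnn (fun x hx => (B x hx).2.1.1)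
  have N4 := finset_le_list_sum (T := fun x => (nbrRow m z w ed en hn hd PL' PH' P1L' P1H' x).2.2.2.1) hln hlnn (fun x hx => (B x hx).2.1.2)
  have N5 := list_sum_le_finset (T := fun x => (nbrRow m z w ed en hn hd PL' PH' P1L' P1H' x).2.2.2.2.1) hln hlnn (fun x hx => (B x hx).2.2.1)
  have N6 := finset_le_list_sum (T := fun x => (nbrRow m z w ed en hn hd PL' PH' P1L' P1H' x).2.2.2.2.2) hln hlnn (fun x hx => (B x hx).2.2.2)
  have L0 := L 0; have L1 := L 1; have L2 := L 2
  push_cast at O1 O2 O3 O4 O5 O6 N1 N2 N3 N4 N5 N6 L0 L1 L2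
  by_cases hMI : m ∈ MI
  · have hob : own = true := by rw [hownb]; exact decide_eq_true hMI
    have hR : nashAccF m z w D ed en hn hd P0L P0H PL PH P1L P1H PL' PH' P1L' P1H' own lOwn lNbr
        = (leadILo P0L P0H D ed hn hd (z m) 0 - (lOwn.map fun m' => (ownRow m z w ed en hn hd PL PH P1L P1H m').2.1).sum
              + (lNbr.map fun x => (nbrRow m z w ed en hn hd PL' PH' P1L' P1H' x).1).sum,
           leadIHi P0L P0H D ed hn hd (z m) 0 - (lOwn.map fun m' => (ownRow m z w ed en hn hd PL PH P1L P1H m').1).sum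
              + (lNbr.map fun x => (nbrRow m z w ed en hn hd PL' PH' P1L' P1H' x).2.1).sum,
           leadILo P0L P0H D ed hn hd (z m) 1 - (lOwn.map fun m' => (ownRow m z w ed en hn hd PL PH P1L P1H m').2.2.2.1).sum
              + (lNbr.map fun x => (nbrRow m z w ed en hn hd PL' PH' P1L' P1H' x).2.2.1).sum,
           leadIHi P0L P0H D ed hn hd (z m) 1 - (lOwn.map fun m' => (ownRow m z w ed en hn hd PL PH P1L P1H m').2.2.1).sum
              + (lNbr.map fun x => (nbrRow m z w ed en hn hd PL' PH' P1L' P1H' x).2.2.2.1).sum,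
           leadILo P0L P0H D ed hn hd (z m) 2 - (lOwn.map fun m' => (ownRow m z w ed en hn hd PL PH P1L P1H m').2.2.2.2.2).sum
              + (lNbr.map fun x => (nbrRow m z w ed en hn hd PL' PH' P1L' P1H' x).2.2.2.2.1).sum,
           leadIHi P0L P0H D ed hn hd (z m) 2 - (lOwn.map fun m' => (ownRow m z w ed en hn hd PL PH P1L P1H m').2.2.2.2.1).sum
              + (lNbr.map fun x => (nbrRow m z w ed en hn hd PL' PH' P1L' P1H' x).2.2.2.2.2).sum) := by
      unfold nashAccF
      simp only [hob, if_true, foldl_accSub, foldl_accAdd]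
    rw [hR]; dsimp only
    push_cast
    refine ⟨⟨?_, ?_⟩, ⟨?_, ?_⟩, ⟨?_, ?_⟩⟩
    · rw [e 0]; simp only [hMI, if_true]; linarith [L0.1, O1, N1]
    · rw [e 0]; simp only [hMI, if_true]; linarith [L0.2, O2, N2]
    · rw [e 1]; simp only [hMI, if_true]; linarith [L1.1, O3, N3]
    · rw [e 1]; simp only [hMI, if_true]; linarith [L1.2, O4, N4]
    · rw [e 2]; simp only [hMI, if_true]; linarith [L2.1, O5, N5]
    · rw [e 2]; simp only [hMI, if_true]; linarith [L2.2, O6, N6]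
  · have hob : own = false := by rw [hownb]; exact decide_eq_false hMI
    have hR : nashAccF m z w D ed en hn hd P0L P0H PL PH P1L P1H PL' PH' P1L' P1H' own lOwn lNbr
        = (leadILo P0L P0H D ed hn hd (z m) 0 + (lNbr.map fun x => (nbrRow m z w ed en hn hd PL' PH' P1L' P1H' x).1).sum,
           leadIHi P0L P0H D ed hn hd (z m) 0 + (lNbr.map fun x => (nbrRow m z w ed en hn hd PL' PH' P1L' P1H' x).2.1).sum,
           leadILo P0L P0H D ed hn hd (z m) 1 + (lNbr.map fun x => (nbrRow m z w ed en hn hd PL' PH' P1L' P1H' x).2.2.1).sum,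
           leadIHi P0L P0H D ed hn hd (z m) 1 + (lNbr.map fun x => (nbrRow m z w ed en hn hd PL' PH' P1L' P1H' x).2.2.2.1).sum,
           leadILo P0L P0H D ed hn hd (z m) 2 + (lNbr.map fun x => (nbrRow m z w ed en hn hd PL' PH' P1L' P1H' x).2.2.2.2.1).sum,
           leadIHi P0L P0H D ed hn hd (z m) 2 + (lNbr.map fun x => (nbrRow m z w ed en hn hd PL' PH' P1L' P1H' x).2.2.2.2.2).sum) := by
      unfold nashAccF
      simp only [hob, Bool.false_eq_true, if_false, foldl_accAdd]
    rw [hR]; dsimp only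
    push_cast
    refine ⟨⟨?_, ?_⟩, ⟨?_, ?_⟩, ⟨?_, ?_⟩⟩
    · rw [e 0]; simp only [hMI, if_false]; linarith [L0.1, N1]
    · rw [e 0]; simp only [hMI, if_false]; linarith [L0.2, N2]
    · rw [e 1]; simp only [hMI, if_false]; linarith [L1.1, N3]
    · rw [e 1]; simp only [hMI, if_false]; linarith [L1.2, N4]
    · rw [e 2]; simp only [hMI, if_false]; linarith [L2.1, N5]
    · rw [e 2]; simp only [hMI, if_false]; linarith [L2.2, N6]

end Mem

end Summit.AtomisticToContinuum.Crystallization.Theorems.FrustratedLawDichotomyCellArithNashFold
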